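import Summits.KontsevichZagierPeriods.KontsevichZagierPeriods.Theorems.LiftingCriteriaDilationTransferOfTameStokes

/-!
# The conclusion of `DilationTransfer` for ONE datum from the cube kernel of its specialised integrand (crux stmt-KontsevichZagierPeriods-3572)

Support file for crux `DilationTransfer`
(`Summit.KontsevichZagierPeriods.KontsevichZagierPeriods.Theses.LiftingCriteria.DilationTransfer`,
route `LiftingCriteria`, line `birth`, reshape 4). `dilationTransfer_of_pencilCubeKernel`
(`Theorems/LiftingCriteriaDilationTransferOfCubeKernel.lean`) derives the WHOLE crux from the cube
kernel of EVERY datum; unconditional rungs of the crux (sub-cases proved outright) need the same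
recombination DATUM BY DATUM, with no functional-relation witness in sight:

* `conclusion_of_cubeKernel` — for fixed cube-Nash `gᵢ`, integers `mᵢ, m₀` and a rational
  `ϖ₀ ∈ (0,1]`: if on some common cube `[0,1]^D` (`nᵢ ≤ D`) every representation
  `[[0,1]^D, f₀ ∘ π]` of the specialised integrand `f₀(z) = m₀ + Σ mᵢ gᵢ(ϖ₀·πᵢ z)` is a relation,
  then `m₀·[u] + Σ mᵢ·[rᵢ] ∈ KZ.relations` for all representations `rᵢ` of `∫_{[0,1]^{nᵢ}} gᵢ(ϖ₀z)dz`
  on the closed cubes and every unit representation `u` of dimension `0` — the conclusion of the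
  crux for this datum. Proof: congruence with tame cube representations, padding (`tame_liftLE`),
  integer scaling (`reduction_of_constMul_int_sub_zsmul_mem_relations`), integrand additivity
  (`KZ.of_sub_sum_integrand_mem_relations`).

## References
* M. Kontsevich, D. Zagier, *Periods* (2001), §1.2 (rules (1)–(3)).
-/

noncomputable section

open scoped BigOperators
open MeasureTheory Set Filter
open Literature.NumberTheory.Transcendental
open Literature.ModelTheory.ExponentialFields (IsSemialgebraic)
open Summit.KontsevichZagierPeriods.InverseLandau.TateFamilyKernel
open Summit.KontsevichZagierPeriods.HermiteRigidity.RealEllipticSectorKernel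
  (reduction_of_constMul_int_sub_zsmul_mem_relations)

namespace Summit.KontsevichZagierPeriods.LiftingCriteria.DilationTransfer

/-- **The conclusion of `DilationTransfer` for one datum, from the cube kernel of its specialised
integrand.** For cube-Nash `gᵢ` (open `Uᵢ ⊇ [0,1]^{nᵢ}`), integers `mᵢ, m₀` and a rational
`ϖ₀ ∈ (0,1]`: if on a common cube `[0,1]^D` (`nᵢ ≤ D`) every representation `[[0,1]^D, f₀ ∘ π]` of
`f₀(z) = m₀ + Σ mᵢ gᵢ(ϖ₀·πᵢ z)` is a relation, then `m₀·[u] + Σ mᵢ·[rᵢ] ∈ KZ.relations` for all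
closed-cube representations `rᵢ` of the `gᵢ(ϖ₀·)` and every unit representation `u`.
[cite: KontsevichZagier2001, §1.2] -/
theorem conclusion_of_cubeKernel :
    ∀ (S : ℕ) (n : Fin S → ℕ) (g : (i : Fin S) → (Fin (n i) → ℝ) → ℝ) (U : (i : Fin S) → Set (Fin (n i) → ℝ)), (∀ i, IsOpen (U i) ∧ Set.pi Set.univ (fun _ : Fin (n i) => Set.Icc (0:ℝ) 1) ⊆ (U i) ∧ Literature.NumberTheory.Transcendental.IsSemialgebraicFunOn ℚ (U i) (g i) ∧ AnalyticOnNhd ℝ (g i) (U i)) → ∀ (m : Fin S → ℤ) (m₀ : ℤ) (ϖ₀ : ℚ), 0 < ϖ₀ → ϖ₀ ≤ 1 → ∀ (D : ℕ) (hn : ∀ i, n i ≤ D), (∀ (A : Literature.NumberTheory.Transcendental.KZ.IntegralRep D), A.domain = Literature.NumberTheory.Transcendental.KZ.cube D → (∀ v ∈ Literature.NumberTheory.Transcendental.KZ.cube D, A.integrand v = (m₀ : ℝ) + ∑ i, (m i : ℝ) * g i ((ϖ₀ : ℝ) • (fun l : Fin (n i) => v (Fin.castLE (hn i) l)))) → Literature.NumberTheory.Transcendental.KZ.of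 A ∈ Literature.NumberTheory.Transcendental.KZ.relations) → ∀ (r : (i : Fin S) → Literature.NumberTheory.Transcendental.KZ.IntegralRep (n i)) (u : Literature.NumberTheory.Transcendental.KZ.IntegralRep 0), (∀ i, (r i).domain = Set.pi Set.univ (fun _ : Fin (n i) => Set.Icc (0:ℝ) 1) ∧ ∀ z ∈ Set.pi Set.univ (fun _ : Fin (n i) => Set.Icc (0:ℝ) 1), (r i).integrand z = g i ((ϖ₀ : ℝ) • z)) → u.domain = Set.univ → (∀ x, u.integrand x = 1) → m₀ • Literature.NumberTheory.Transcendental.KZ.of u + ∑ i, m i • Literature.NumberTheory.Transcendental.KZ.of (r i) ∈ Literature.NumberTheory.Transcendental.KZ.relations := by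
  intro S n g U hg m m₀ ϖ₀ hϖ0 hϖ1 D hle hker r u hr hu1 hu2
  -- real casts of the parameter
  have hϖ0' : (0 : ℝ) ≤ (ϖ₀ : ℝ) := by exact_mod_cast hϖ0.le
  have hϖ1' : (ϖ₀ : ℝ) ≤ 1 := by exact_mod_cast hϖ1
  have hcubeU : ∀ i, KZ.cube (n i) ⊆ U i := fun i => by rw [KZ.cube_eq_pi]; exact (hg i).2.1
  -- (1) the specialised integrands `z ↦ gᵢ(ϖ₀ z)` are tame on their cubes
  have ha : ∀ i, AnalyticOnNhd ℝ (fun z : Fin (n i) → ℝ => g i ((ϖ₀ : ℝ) • z)) (KZ.cube (n i)) := by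
    intro i z hz
    have hgz : AnalyticAt ℝ (g i) ((ϖ₀ : ℝ) • z) :=
      (hg i).2.2.2 _ (hcubeU i (smul_mem_cube_of_le hϖ0' hϖ1' hz))
    have hL : AnalyticAt ℝ (fun z : Fin (n i) → ℝ => (ϖ₀ : ℝ) • z) z :=
      ((ϖ₀ : ℝ) • ContinuousLinearMap.id ℝ (Fin (n i) → ℝ)).analyticAt z
    exact hgz.comp hL
  have hs : ∀ i, IsSemialgebraicFunOn ℚ (KZ.cube (n i)) (fun z : Fin (n i) → ℝ => g i ((ϖ₀ : ℝ) • z)) := by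
    intro i
    have hmap : IsSemialgebraicMapOn ℚ (KZ.cube (n i)) (fun z : Fin (n i) → ℝ => (ϖ₀ : ℝ) • z) :=
      IsSemialgebraicMapOn.of_forall KZ.isSemialgebraic_cube fun l =>
        ((isSemialgebraicFunOn_const_ratCast KZ.isSemialgebraic_cube ϖ₀).fun_mul
          (isSemialgebraicFunOn_apply KZ.isSemialgebraic_cube l)).congr fun z _ => by
            simp [Pi.smul_apply, smul_eq_mul]
    exact IsSemialgebraicFunOn.comp_isSemialgebraicMapOn_holds (hg i).2.2.1 hmap
      fun z hz => hcubeU i (smul_mem_cube_of_le hϖ0' hϖ1' hz)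
  -- tame representations `r'ᵢ = [[0,1]^{nᵢ}, gᵢ(ϖ₀ ·)]`, congruent to the given `rᵢ`
  have hex1 : ∀ i, ∃ ρ : KZ.IntegralRep (n i), ρ.IsTameCube ∧
      ρ.integrand = fun z => g i ((ϖ₀ : ℝ) • z) :=
    fun i => ⟨KZ.IntegralRep.tameCube _ (ha i) (hs i), KZ.IntegralRep.isTameCube_tameCube _ _ _, rfl⟩
  choose r' hr't hr'i using hex1
  have hr'r : ∀ i, KZ.of (r' i) - KZ.of (r i) ∈ KZ.relations := by
    intro i
    refine KZ.of_sub_of_mem_relations_of_eqOn ?_ fun z hz => ?_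
    · rw [(hr i).1, (hr't i).domain_eq, KZ.cube_eq_pi]
    · rw [(hr't i).domain_eq] at hz
      have hz' : z ∈ Set.pi Set.univ (fun _ : Fin (n i) => Set.Icc (0:ℝ) 1) := by
        rw [← KZ.cube_eq_pi]; exact hz
      rw [hr'i i]
      exact ((hr i).2 z hz').symm
  -- (2) pad to the common cube `[0,1]^D`
  have hex2 : ∀ i, ∃ ρ : KZ.IntegralRep D, ρ.IsTameCube ∧
      ρ.integrand = fun v => g i ((ϖ₀ : ℝ) • (fun l : Fin (n i) => v (Fin.castLE (hle i) l))) :=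
    fun i => ⟨KZ.IntegralRep.tameCube _ (analyticOnNhd_comp_castLE (hle i) (ha i))
      (isSemialgebraicFunOn_cube_comp_castLE (hle i) (hs i)), KZ.IntegralRep.isTameCube_tameCube _ _ _, rfl⟩
  choose R hRt hRi using hex2
  have hRr' : ∀ i, KZ.of (R i) - KZ.of (r' i) ∈ KZ.relations := fun i =>
    tame_liftLE (ha i) (hs i) D (hle i) (R i) (hRt i) (fun w _ => by rw [hRi i])
      (r' i) (hr't i) (fun x _ => by rw [hr'i i])
  -- the unit representation `u = [pt, 1]`, tame in dimension `0`, padded to `[0,1]^D`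
  have hut : u.IsTameCube := by
    refine ⟨by rw [hu1, KZ.cube_zero], ?_⟩
    have : u.integrand = fun _ => 1 := funext hu2
    rw [this]
    exact analyticOnNhd_const
  have h1s : IsSemialgebraicFunOn ℚ (KZ.cube 0) (fun _ : Fin 0 → ℝ => (1 : ℝ)) := by
    simpa using isSemialgebraicFunOn_const_natCast (KZ.isSemialgebraic_cube (n := 0)) 1
  have h1sD : IsSemialgebraicFunOn ℚ (KZ.cube D) (fun _ : Fin D → ℝ => (1 : ℝ)) := by
    simpa using isSemialgebraicFunOn_const_natCast (KZ.isSemialgebraic_cube (n := D)) 1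
  obtain ⟨One, hOt, hOi⟩ : ∃ ρ : KZ.IntegralRep D, ρ.IsTameCube ∧
      ρ.integrand = fun _ => (1 : ℝ) :=
    ⟨KZ.IntegralRep.tameCube _ analyticOnNhd_const h1sD, KZ.IntegralRep.isTameCube_tameCube _ _ _, rfl⟩
  have hOu : KZ.of One - KZ.of u ∈ KZ.relations :=
    tame_liftLE (u := fun _ : Fin 0 → ℝ => (1 : ℝ)) analyticOnNhd_const h1s D (Nat.zero_le _)
      One hOt (fun w _ => by rw [hOi]) u hut (fun x _ => hu2 x)
  -- (3) the specialised pencil integrand `f₀ ∘ π` on `[0,1]^D` and its tame representation `A`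
  have hf0s : IsSemialgebraicFunOn ℚ (KZ.cube D) (fun v : Fin D → ℝ =>
      (m₀ : ℝ) + ∑ i, (m i : ℝ) * g i ((ϖ₀ : ℝ) • (fun l : Fin (n i) => v (Fin.castLE (hle i) l)))) := by
    have hterm : ∀ i ∈ (Finset.univ : Finset (Fin S)), IsSemialgebraicFunOn ℚ (KZ.cube D)
        (fun v : Fin D → ℝ => (m i : ℝ) * g i ((ϖ₀ : ℝ) • (fun l : Fin (n i) => v (Fin.castLE (hle i) l)))) :=
      fun i _ => (isSemialgebraicFunOn_const_intCast KZ.isSemialgebraic_cube (m i)).fun_mul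
        (isSemialgebraicFunOn_cube_comp_castLE (hle i) (hs i))
    exact (isSemialgebraicFunOn_const_intCast KZ.isSemialgebraic_cube m₀).fun_add
      (IsSemialgebraicFunOn.fun_finsetSum Finset.univ KZ.isSemialgebraic_cube hterm)
  have hf0a : AnalyticOnNhd ℝ (fun v : Fin D → ℝ =>
      (m₀ : ℝ) + ∑ i, (m i : ℝ) * g i ((ϖ₀ : ℝ) • (fun l : Fin (n i) => v (Fin.castLE (hle i) l))))
      (KZ.cube D) := by
    intro v hv
    have hsum : AnalyticAt ℝ (fun v : Fin D → ℝ =>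
        ∑ i, (m i : ℝ) * g i ((ϖ₀ : ℝ) • (fun l : Fin (n i) => v (Fin.castLE (hle i) l)))) v :=
      Finset.analyticAt_fun_sum (f := fun i (v : Fin D → ℝ) =>
          (m i : ℝ) * g i ((ϖ₀ : ℝ) • (fun l : Fin (n i) => v (Fin.castLE (hle i) l))))
        Finset.univ fun i _ => analyticAt_const.fun_mul (analyticOnNhd_comp_castLE (hle i) (ha i) v hv)
    exact analyticAt_const.fun_add hsum
  obtain ⟨A, hAt, hAi⟩ : ∃ ρ : KZ.IntegralRep D, ρ.IsTameCube ∧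
      ρ.integrand = fun v : Fin D → ℝ =>
        (m₀ : ℝ) + ∑ i, (m i : ℝ) * g i ((ϖ₀ : ℝ) • (fun l : Fin (n i) => v (Fin.castLE (hle i) l))) :=
    ⟨KZ.IntegralRep.tameCube _ hf0a hf0s, KZ.IntegralRep.isTameCube_tameCube _ _ _, rfl⟩
  -- (4) the cube kernel hypothesis: `[A]` is a relation
  have hA : KZ.of A ∈ KZ.relations := hker A hAt.domain_eq (fun v _ => by rw [hAi])
  -- (5) recombination in the four-move calculus: scaled representations and additivity
  set Rc : Option (Fin S) → KZ.IntegralRep D := fun o =>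
    o.elim (One.constMul (m₀ : ℝ) (isAlgebraic_int m₀))
      (fun i => (R i).constMul (m i : ℝ) (isAlgebraic_int (m i))) with hRc
  have hRc0 : Rc none = One.constMul (m₀ : ℝ) (isAlgebraic_int m₀) := rfl
  have hRcs : ∀ i, Rc (some i) = (R i).constMul (m i : ℝ) (isAlgebraic_int (m i)) := fun i => rfl
  have hsum : KZ.of A - ∑ o, KZ.of (Rc o) ∈ KZ.relations := by
    refine KZ.of_sub_sum_integrand_mem_relations Finset.univ Rc A (fun o _ => ?_) fun v hv => ?_
    · cases o with
      | none => rw [hRc0, KZ.IntegralRep.domain_constMul, hOt.domain_eq, hAt.domain_eq]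
      | some i => rw [hRcs i, KZ.IntegralRep.domain_constMul, (hRt i).domain_eq, hAt.domain_eq]
    · show A.integrand v = ∑ o, (Rc o).integrand v
      rw [Fintype.sum_option]
      simp only [hRc0, hRcs, KZ.IntegralRep.integrand_constMul, hAi, hOi, hRi, mul_one]
  have hsc0 : KZ.of (Rc none) - m₀ • KZ.of One ∈ KZ.relations := by
    rw [hRc0]; exact reduction_of_constMul_int_sub_zsmul_mem_relations One m₀
  have hsci : ∀ i, KZ.of (Rc (some i)) - m i • KZ.of (R i) ∈ KZ.relations := fun i => by
    rw [hRcs i]; exact reduction_of_constMul_int_sub_zsmul_mem_relations (R i) (m i)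
  -- (6) assembly of the pieces
  have step1 : KZ.of (Rc none) + ∑ i, KZ.of (Rc (some i)) ∈ KZ.relations := by
    have h := KZ.relations.sub_mem hA hsum
    rw [sub_sub_cancel, Fintype.sum_option] at h
    exact h
  have step2 : m₀ • KZ.of One + ∑ i, m i • KZ.of (R i) ∈ KZ.relations := by
    have h4 : ∑ i, (KZ.of (Rc (some i)) - m i • KZ.of (R i)) ∈ KZ.relations :=
      KZ.relations.sum_mem fun i _ => hsci i
    have h := KZ.relations.sub_mem (KZ.relations.sub_mem step1 hsc0) h4
    have e : KZ.of (Rc none) + ∑ i, KZ.of (Rc (some i)) - (KZ.of (Rc none) - m₀ • KZ.of One) -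
        ∑ i, (KZ.of (Rc (some i)) - m i • KZ.of (R i)) = m₀ • KZ.of One + ∑ i, m i • KZ.of (R i) := by
      rw [Finset.sum_sub_distrib]; abel
    rwa [e] at h
  have step3 : m₀ • KZ.of u + ∑ i, m i • KZ.of (r i) ∈ KZ.relations := by
    have h5 : m₀ • (KZ.of One - KZ.of u) ∈ KZ.relations := KZ.relations.zsmul_mem hOu m₀
    have h6 : ∑ i, m i • (KZ.of (R i) - KZ.of (r i)) ∈ KZ.relations :=
      KZ.relations.sum_mem fun i _ => KZ.relations.zsmul_mem
        (by have := KZ.relations.add_mem (hRr' i) (hr'r i); rwa [sub_add_sub_cancel] at this) (m i)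
    have h := KZ.relations.sub_mem (KZ.relations.sub_mem step2 h5) h6
    have e : m₀ • KZ.of One + ∑ i, m i • KZ.of (R i) - m₀ • (KZ.of One - KZ.of u) -
        ∑ i, m i • (KZ.of (R i) - KZ.of (r i)) = m₀ • KZ.of u + ∑ i, m i • KZ.of (r i) := by
      simp only [zsmul_sub, Finset.sum_sub_distrib]; abel
    rwa [e] at h
  exact step3

end Summit.KontsevichZagierPeriods.LiftingCriteria.DilationTransfer
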